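import Summits.BirchSwinnertonDyer.Rank1Residual.Supersingular.SignedLambdaParity
import Mathlib.RingTheory.Polynomial.Cyclotomic.Roots
import Mathlib.FieldTheory.Minpoly.Field
import HarnessLib

/-!
# A Mazur–Tate certificate forbids vanishing twists: `μ(θ_n) = 0`, `λ(θ_n) < φ(pⁿ)` ⇒
# `L(E, χ, 1) ≠ 0` for EVERY character `χ` of `Gal(ℚ_∞/ℚ)` of order `pⁿ`
# (cell `b2b-bsdres`, supersingular family, prover B = unit `b2b-bsdres-additive-p3`, gen 6; part 1: the `p`-adic side)

HONEST FRAMING (run/shared/lean/b2b/bsd-rank1-residual/, verbatim in every file): the goal of the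
cell is to DELETE the COMBINATION-SHAPED residual classes of the Birch–Swinnerton-Dyer formula for
ALL analytic-rank `≤ 1` elliptic curves over `ℚ` — "full BSD formula for every rank `≤ 1` curve in
class `C`" assembled STRICTLY from published theorems — so that the rank-`≤ 1` remainder becomes
exactly the CONSTRUCTION-SHAPED classes, which are TYPED (missing-input `Prop`s), NOT attempted.
This is not "finishing BSD". THEOREMS ONLY (no named fact, no `sorry`); nothing about any particular
curve is asserted; nothing is booked; X8 / X7 / X6 stay CONSTRUCTION-SHAPED.

## What this file proves, and why

The cell's supersingular census (iw-2, two engines; kernel records `MazurTateRecords*.lean`, 222 rows)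
records for every analytic-rank-one X8 / X7 pair ONE Mazur–Tate element `θ_n` per colour with
`μ(θ_n) = 0` and its `λ(θ_n) = deg ω_n^± + λ(L^•)`. Gens 4–5 read `(μ, λ)(L^•)` and the parity of `λ`
out of such a row. This file reads a THIRD piece of arithmetic out of the same row, with no new input:

* `ratTwistedSymbolSum_ne_zero_of_mazurTate` (**the layer theorem**, any prime `p`, any level, any
  reduction type): if `Θ ∈ Λ = ℤ_p⟦T⟧` is the Mazur–Tate element `θ_n(f)` (`ι Θ = θ_n`, `n ≥ 1`) with
  `Θ ≠ 0`, `μ(Θ) = 0` and **`λ(Θ) < φ(pⁿ) = pⁿ⁻¹(p − 1)`**, then for EVERY primitive Dirichlet character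
  `χ` of conductor `p^{n+e₀}` with values in `ℂ_p`, even and of `p`-power order (= a character of
  `Γ = Gal(ℚ_∞/ℚ)` of order exactly `pⁿ`), Birch's twisted symbol sum
  `∑_a χ(a) [a/p^{n+e₀}]⁺_f` (`= τ(χ) L(f, χ̄, 1)/Ω⁺_f`, `ratTwistedSymbolSum_mul_plusPeriod`) is
  **non-zero**. Proof: the sum is `θ_n(ζ − 1)`, `ζ = χ(γ)` a primitive `pⁿ`-th root of unity
  (`eval₂_mazurTateElement_eq_ratTwistedSymbolSum`, `orderOf_apply_cyclotomicGenerator`); if it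
  vanished, the minimal polynomial `Φ_{pⁿ}(X + 1)` of `ζ − 1` over `ℚ` would divide `θ_n ∈ ℚ[X]`;
  being monic it divides the `p`-integral polynomial `Θ` in `ℤ_p[X]` (`dvd_of_map_dvd_map_of_injective`),
  and modulo `p` it is `X^{φ(pⁿ)}` (Eisenstein, `map_residue_cyclotomic_comp`), so `X^{φ(pⁿ)} ∣ Θ̄ ≠ 0`
  and `λ(Θ) = ord_T Θ̄ ≥ φ(pⁿ)` — contradiction. (An EFFECTIVE, per-curve form of Rohrlich's
  theorem at the layers the certificate reaches; cf. Kurihara–Pollack 2007, §0.3 / Prop. 3.1, where the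
  rank jumps `e_n` in the cyclotomic tower are the input.)
* `ratTwistedSymbolSum_ne_zero_of_lam_sharp_lt` / `_of_lam_flat_lt`: for `p ≠ 2` good with `p ∣ a_p`
  (X8: `a_3 = ±3`; X6/X7: `a_p = 0`) and THE Sprung pair `(L♯, L♭)` (`IsSprungPair`, unique): `L♯ ≠ 0`,
  `μ(L♯) = 0`, `n` odd and `λ(L♯) + deg ω_n^+ < φ(pⁿ)` ⇒ the same conclusion at layer `n` (via the
  single-layer exactness `lam_eq_lam_add_of_mu_eq_zero_of_odd`, gen 4); `♭` at even layers.
* (sequel `MazurTateTwistedNonvanishingLayers.lean`) `forall_odd_ratTwistedSymbolSum_ne_zero_of_lam_sharp_le` /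
  `forall_even_…_of_lam_flat_le` (**all layers from ONE invariant**): `λ(L♯) ≤ p − 2` ⇒ non-vanishing at EVERY odd layer;
  `λ(L♭) + p ≤ p(p − 1)` ⇒ at EVERY even layer `n ≥ 2` (the inequality propagates from `n` to `n + 2`
  because `φ(pⁿ) + φ(pⁿ⁺¹) ≤ φ(pⁿ⁺²)`). At `p = 3`: `λ♯ = 1`, resp. `λ♭ ∈ {1, 3}`.
* `a_p = 0` forms for Kobayashi–Pollack's `L_p^ε` (`IsSignedPAdicLFunction`, X6/X7) and X8 readings.

READING for the cell (numbers, not adjectives; nothing booked): on the 39 X8 rank-one pairs the kernel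
records give `(λ♯, λ♭) = (1, 1)` on 19 pairs — for these `L(E, χ, 1) ≠ 0` for EVERY non-trivial
character `χ` of `3`-power order and conductor (every character of `Gal(ℚ_∞/ℚ)`, `ℚ_∞` the cyclotomic
`ℤ_3`-extension): by the interpolation property no twist of `E` by a character of the `ℤ_3`-tower is
analytically of positive rank, although `L(E, 1) = 0`; on the pairs with `λ♯ = 3` the only layer left
open is `n = 1` (the two cubic characters of conductor `9`), etc. Part 2 (complex side + Kato's
Cor. 14.3: no Mordell–Weil growth in the tower) is a separate file.

References: Mazur–Tate–Teitelbaum, Invent. Math. 84 (1986) §I.13 (interpolation at wild characters);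
R. Pollack, Duke Math. J. 118 (2003), Prop. 6.9, Def. 6.15, Lemma 4.7; F. Sprung, ANT 11 (2017) §3,
Cor. 3.6; M. Kurihara, R. Pollack, *Two p-adic L-functions and rational points on elliptic curves with
supersingular reduction*, LMS Lecture Note Ser. 320 (2007), §0.3 and Prop. 3.1; D. Rohrlich, Invent.
Math. 75 (1984); L. Washington, GTM 83, §7.1. Memo: `HOME/b2b-bsdres-additive-p3/X8-ROUTE-B.md` §11.
-/

set_option autoImplicit false

noncomputable section

open scoped Classical MatrixGroups ModularForm

open CongruenceSubgroup Polynomial WeierstrassCurve Literature.NumberTheory.EllipticCurves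
  Literature.NumberTheory.EllipticCurves.ModularForms
  Literature.NumberTheory.EllipticCurves.Sprung2017
  Literature.NumberTheory.EllipticCurves.Rank1Residual
  Summit.BirchSwinnertonDyer.Rank1Residual.X1.MuLambda

namespace Summit.BirchSwinnertonDyer.Rank1Residual.Supersingular

/-! ## §1. Algebra -/

section Algebra

/-- **`Φ_m(X + 1)` divides every rational polynomial vanishing at `ζ − 1`**, `ζ` a primitive `m`-th
root of unity in a field of characteristic zero: `Φ_m(X+1)` is the minimal polynomial of `ζ − 1`
over `ℚ` (Mathlib `cyclotomic_eq_minpoly_rat`, `minpoly.sub_algebraMap`). [folklore] -/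
theorem cyclotomic_comp_X_add_one_dvd_of_eval₂_eq_zero {K : Type*} [Field K] [CharZero K]
    {ζ : K} {m : ℕ} (hζ : IsPrimitiveRoot ζ m) (hm : 0 < m) {q : ℚ[X]}
    (hq : q.eval₂ (algebraMap ℚ K) (ζ - 1) = 0) :
    (cyclotomic m ℚ).comp (X + 1) ∣ q := by
  have h1 : minpoly ℚ (ζ - 1) = (cyclotomic m ℚ).comp (X + 1) := by
    have h := minpoly.sub_algebraMap (A := ℚ) ζ (1 : ℚ)
    rw [map_one, map_one, ← cyclotomic_eq_minpoly_rat hζ hm] at h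
    exact h
  rw [← h1]
  exact minpoly.dvd ℚ (ζ - 1) (by rw [aeval_def]; exact hq)

/-- `deg Φ_m(X + 1) = φ(m)` over `ℤ`. [folklore] -/
theorem natDegree_cyclotomic_comp_X_add_one_int (m : ℕ) :
    ((cyclotomic m ℤ).comp (X + 1)).natDegree = Nat.totient m := by
  rw [natDegree_comp, natDegree_cyclotomic, ← C_1, natDegree_X_add_C, mul_one]

/-- **`φ(pⁿ) + φ(pⁿ⁺¹) ≤ φ(pⁿ⁺²)`** for a prime `p` and `n ≥ 1` (`1 + p ≤ p²`): the step that
propagates the inequality `λ + deg ω_n^± < φ(pⁿ)` from a layer to the next layer of the same parity.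
[folklore] -/
theorem totient_add_totient_succ_le {p : ℕ} (hp : p.Prime) {n : ℕ} (hn : 0 < n) :
    Nat.totient (p ^ n) + Nat.totient (p ^ (n + 1)) ≤ Nat.totient (p ^ (n + 2)) := by
  obtain ⟨m, rfl⟩ : ∃ m, n = m + 1 := ⟨n - 1, by omega⟩
  rw [Nat.totient_prime_pow_succ hp, Nat.totient_prime_pow_succ hp,
    show m + 1 + 2 = (m + 2) + 1 by ring, Nat.totient_prime_pow_succ hp, pow_succ, pow_succ, pow_succ]
  have h2 : 2 ≤ p := hp.two_le
  have hpm : 0 < p ^ m := pow_pos hp.pos m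
  have key : p ^ m * (p - 1) + p ^ m * p * (p - 1) ≤ p ^ m * p * p * (p - 1) := by
    have h3 : 1 + p ≤ p * p := by nlinarith
    calc p ^ m * (p - 1) + p ^ m * p * (p - 1) = p ^ m * (p - 1) * (1 + p) := by ring
      _ ≤ p ^ m * (p - 1) * (p * p) := Nat.mul_le_mul_left _ h3
      _ = p ^ m * p * p * (p - 1) := by ring
  exact key

end Algebra

/-! ## §2. THE LAYER THEOREM: `λ(θ_n) < φ(pⁿ)` ⇒ no vanishing twist of order `pⁿ` -/

section Layer

variable {N : ℕ} {f : CuspForm (Gamma0 N) 2} {p : ℕ} [hp : Fact p.Prime]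

/-- **A Mazur–Tate certificate forbids vanishing twists at its layer.** Let `f ∈ S₂(Γ₀(N))`, `p` any
prime, `n ≥ 1`, and let `Θ ∈ Λ = ℤ_p⟦T⟧` be the Mazur–Tate element `θ_n(f)` (`ι Θ = θ_n`) with `Θ ≠ 0`,
`μ(Θ) = 0` and `λ(Θ) < φ(pⁿ)`. Then for every primitive Dirichlet character `χ` of conductor `p^{n+e₀}`
with values in `ℂ_p`, even and of `p`-power order (a character of `Γ` of order `pⁿ`), Birch's sum
`∑_a χ(a) [a/p^{n+e₀}]⁺_f ≠ 0` (`= τ(χ) L(f, χ̄, 1)/Ω⁺_f`). Proof: the sum is `θ_n(ζ − 1)` with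
`ζ = χ(γ)` of order `pⁿ`; were it `0`, `Φ_{pⁿ}(X+1) ∣ θ_n` in `ℚ[X]` (minimal polynomial), hence in
`ℤ_p[X]` (monic divisor), hence `X^{φ(pⁿ)} ∣ Θ̄` in `𝔽_p[X]` (Eisenstein), so `λ(Θ) = ord_T Θ̄ ≥ φ(pⁿ)`.
[cite: MazurTateTeitelbaum1986Invent, §I.13] [cite: Pollack2003, Prop. 6.9 (proof) and Def. 6.15] -/
theorem ratTwistedSymbolSum_ne_zero_of_mazurTate {n : ℕ} (hn : 0 < n) {Θ : IwasawaAlgebra p}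
    (hΘ : iwasawaToPowerSeries p Θ =
      ((mazurTateElement f p n).map (algebraMap ℚ ℚ_[p]) : PowerSeries ℚ_[p]))
    (hΘ0 : Θ ≠ 0) (hμ : mu Θ = 0) (hlam : lam Θ < Nat.totient (p ^ n))
    (χ : DirichletCharacter ℂ_[p] (p ^ (n + cyclotomicExponent p))) (hχ : χ.IsPrimitive)
    (hev : χ.Even) (hord : ∃ j : ℕ, orderOf χ = p ^ j) :
    ratTwistedSymbolSum f χ ≠ 0 := by
  intro h0
  -- `ζ = χ(γ)` is a primitive `pⁿ`-th root of unity
  set ζ : ℂ_[p] := χ (cyclotomicGenerator p : ZMod (p ^ (n + cyclotomicExponent p))) with hζdef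
  have hordζ : orderOf ζ = p ^ n := by
    have h1 := orderOf_apply_cyclotomicGenerator (m := n + cyclotomicExponent p)
      (Nat.lt_add_of_pos_left hn) χ hχ hev hord
    rwa [Nat.add_sub_cancel] at h1
  have hprim : IsPrimitiveRoot ζ (p ^ n) := hordζ ▸ IsPrimitiveRoot.orderOf ζ
  have hpn : 0 < p ^ n := pow_pos hp.out.pos n
  -- `θ_n(ζ - 1) = 0`, so `Φ_{pⁿ}(X+1) ∣ θ_n` in `ℚ[X]`
  have heval : (mazurTateElement f p n).eval₂ (algebraMap ℚ ℂ_[p]) (ζ - 1) = 0 := by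
    rw [hζdef, eval₂_mazurTateElement_eq_ratTwistedSymbolSum f χ hev hord, h0]
  have hdvdQ : (cyclotomic (p ^ n) ℚ).comp (X + 1) ∣ mazurTateElement f p n :=
    cyclotomic_comp_X_add_one_dvd_of_eval₂_eq_zero hprim hpn heval
  -- descend to `ℤ_p[X]`: `Φ ∣ trunc Θ`
  obtain ⟨k, rfl⟩ : ∃ k, n = k + 1 := ⟨n - 1, by omega⟩
  set Φ : ℤ[X] := (cyclotomic (p ^ (k + 1)) ℤ).comp (X + 1) with hΦ
  have hΦmon : Φ.Monic := monic_cyclotomic_comp_X_add_one _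
  set Θp : ℤ_[p][X] := PowerSeries.trunc (p ^ (k + 1)) Θ with hΘp
  have hdvdQp : (Φ.map (Int.castRingHom ℤ_[p])).map (algebraMap ℤ_[p] ℚ_[p]) ∣
      Θp.map (algebraMap ℤ_[p] ℚ_[p]) := by
    have hΦQp : (Φ.map (Int.castRingHom ℤ_[p])).map (algebraMap ℤ_[p] ℚ_[p]) =
        (cyclotomic (p ^ (k + 1)) ℚ_[p]).comp (X + 1) := by
      rw [Polynomial.map_map, hΦ, Polynomial.map_comp, map_cyclotomic, Polynomial.map_add, map_X,
        Polynomial.map_one]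
    rw [hΘp, map_trunc_eq_of_mazurTate hΘ, hΦQp]
    have h1 := Polynomial.map_dvd (algebraMap ℚ ℚ_[p]) hdvdQ
    rwa [Polynomial.map_comp, map_cyclotomic, Polynomial.map_add, map_X, Polynomial.map_one] at h1
  have hdvdZp : Φ.map (Int.castRingHom ℤ_[p]) ∣ Θp :=
    dvd_of_map_dvd_map_of_injective (algebraMap ℤ_[p] ℚ_[p]) (IsFractionRing.injective ℤ_[p] ℚ_[p])
      (hΦmon.map _) hdvdQp
  -- reduce modulo `p`: `Φ ↦ X^{φ(p^{k+1})}`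
  set Θbar : (IsLocalRing.ResidueField ℤ_[p])[X] := Θp.map (IsLocalRing.residue ℤ_[p]) with hΘbar
  have hdvdF : (X : (IsLocalRing.ResidueField ℤ_[p])[X]) ^ Nat.totient (p ^ (k + 1)) ∣ Θbar := by
    have h1 := Polynomial.map_dvd (IsLocalRing.residue ℤ_[p]) hdvdZp
    rwa [Polynomial.map_map, hΦ, map_residue_cyclotomic_comp, natDegree_cyclotomic_comp_X_add_one_int]
      at h1
  -- `λ(Θ) = ord_T Θ̄ ≥ φ(p^{k+1})`: contradiction
  have hred : red Θ = (Θbar : PowerSeries (IsLocalRing.ResidueField ℤ_[p])) :=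
    red_eq_coe_map_trunc_of_mazurTate hΘ
  have hredne : red Θ ≠ 0 := red_ne_zero_of_mu_eq_zero hΘ0 hμ
  have hΘbar0 : Θbar ≠ 0 := by
    intro h00
    exact hredne (by rw [hred, h00, Polynomial.coe_zero])
  have hlamEq : lam Θ = Θbar.natTrailingDegree := by
    obtain ⟨-, h⟩ := mu_eq_zero_and_lam_eq_of_red_ne_zero hredne
    rw [hred, order_coe_eq_natTrailingDegree hΘbar0] at h
    exact_mod_cast h
  have hle : Nat.totient (p ^ (k + 1)) ≤ Θbar.natTrailingDegree :=
    le_natTrailingDegree hΘbar0 (Polynomial.X_pow_dvd_iff.mp hdvdF)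
  omega

end Layer

/-! ## §3. For THE Sprung pair: `λ(L♯)` controls the odd layers, `λ(L♭)` the even layers -/

section SharpFlat

variable {W : WeierstrassCurve ℚ} [W.IsElliptic] [W.IsGloballyMinimal] {N : ℕ} [NeZero N]
  {f : CuspForm (Gamma0 N) 2} {p : ℕ} [hp : Fact p.Prime]

/-- **`λ(L♯) + deg ω_n^+ < φ(pⁿ)` ⇒ no vanishing twist of order `pⁿ`, `n` odd.** For `p ≠ 2`, `E = W`
with good reduction at `p` and `p ∣ a_p` (supersingular: `a_p = 0`, or `p = 3`, `a_3 = ±3`), `f` its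
newform, ANY Sprung pair `(L♯, L♭)` (= the unique one), `L♯ ≠ 0`, `μ(L♯) = 0`, and an odd `n` with
`λ(L♯) + deg ω_n^+ < φ(pⁿ)`: every primitive even `p`-power-order `χ` of conductor `p^{n+1}` (values in
`ℂ_p`) has `∑_a χ(a)[a/p^{n+1}]⁺_f ≠ 0`. (Single-layer exactness gives the integral `θ_n` with
`μ = 0`, `λ(θ_n) = λ(L♯) + deg ω_n^+`; then the layer theorem.)
[cite: Sprung2017, §3 and Cor. 3.6] [cite: Pollack2003, Prop. 6.9 and Prop. 6.10] -/
theorem ratTwistedSymbolSum_ne_zero_of_lam_sharp_lt (hp2 : p ≠ 2) (hf : IsNewformOf W f)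
    (hgood : W.HasGoodReductionAtPrime p) (hap : (p : ℤ) ∣ W.frobeniusTrace p)
    {Lsharp Lflat : IwasawaAlgebra p} (hSP : IsSprungPair f p (W.frobeniusTrace p) Lsharp Lflat)
    (hL0 : Lsharp ≠ 0) (hμL : mu Lsharp = 0) {n : ℕ} (hn : Odd n)
    (hlt : lam Lsharp + (cyclotomicOmegaPlus p n).natDegree < Nat.totient (p ^ n))
    (χ : DirichletCharacter ℂ_[p] (p ^ (n + cyclotomicExponent p))) (hχ : χ.IsPrimitive)
    (hev : χ.Even) (hord : ∃ j : ℕ, orderOf χ = p ^ j) :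
    ratTwistedSymbolSum f χ ≠ 0 := by
  obtain ⟨Q, hQ⟩ := exists_integral_mazurTate_of_isSprungPair hp2 hf hgood hap hSP n
  have hlt' : lam Lsharp + (cyclotomicOmegaPlus p n).natDegree < p ^ n :=
    lt_of_lt_of_le hlt (Nat.totient_le _)
  obtain ⟨hΘ0, hμΘ, hlamΘ⟩ := lam_eq_lam_add_of_mu_eq_zero_of_odd hap hn rfl hL0 hμL hlt'
  exact ratTwistedSymbolSum_ne_zero_of_mazurTate hn.pos hQ.symm hΘ0 hμΘ (by omega) χ hχ hev hord

/-- **`λ(L♭) + deg ω_n^- < φ(pⁿ)` ⇒ no vanishing twist of order `pⁿ`, `n ≥ 2` even.**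
[cite: Sprung2017, §3 and Cor. 3.6] [cite: Pollack2003, Prop. 6.9 and Prop. 6.10] -/
theorem ratTwistedSymbolSum_ne_zero_of_lam_flat_lt (hp2 : p ≠ 2) (hf : IsNewformOf W f)
    (hgood : W.HasGoodReductionAtPrime p) (hap : (p : ℤ) ∣ W.frobeniusTrace p)
    {Lsharp Lflat : IwasawaAlgebra p} (hSP : IsSprungPair f p (W.frobeniusTrace p) Lsharp Lflat)
    (hL0 : Lflat ≠ 0) (hμL : mu Lflat = 0) {n : ℕ} (hn : Even n) (hn0 : 0 < n)
    (hlt : lam Lflat + (cyclotomicOmegaMinus p n).natDegree < Nat.totient (p ^ n))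
    (χ : DirichletCharacter ℂ_[p] (p ^ (n + cyclotomicExponent p))) (hχ : χ.IsPrimitive)
    (hev : χ.Even) (hord : ∃ j : ℕ, orderOf χ = p ^ j) :
    ratTwistedSymbolSum f χ ≠ 0 := by
  obtain ⟨Q, hQ⟩ := exists_integral_mazurTate_of_isSprungPair hp2 hf hgood hap hSP n
  have hlt' : lam Lflat + (cyclotomicOmegaMinus p n).natDegree < p ^ n :=
    lt_of_lt_of_le hlt (Nat.totient_le _)
  obtain ⟨hΘ0, hμΘ, hlamΘ⟩ := lam_eq_lam_add_of_mu_eq_zero_of_even hap hn rfl hL0 hμL hlt'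
  exact ratTwistedSymbolSum_ne_zero_of_mazurTate hn0 hQ.symm hΘ0 hμΘ (by omega) χ hχ hev hord

end SharpFlat

end Summit.BirchSwinnertonDyer.Rank1Residual.Supersingular

end
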